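import Summits.Ventures.Crystal3D.Theorems.StickyWulffConstantGenericWallFloorStackWalkRay
import HarnessLib

/-!
# `hfar` for every word length from ONE finite check: the far lattice is not a ray word of the walking grain

HONEST FRAMING. Part of the venture `Summits/Ventures/Crystal3D` (cell `crystal3d-full`), helper `--supports` the
crux `GenericWallFloor` (stmt-Ventures-19480) of `route-Ventures-StickyWulffConstant`, registered line `WallLedgerG`,
open stub `stub_twoSlabAdhesion`; answers the planner's H-2 («capstones for reduced words of length 3, 4, …»,
cf-p1 DECISION (lx)/(lxiii), 2026-08-29).  The one-sided capstone `genericWallFloorAtCharge_oneSided_dirs` is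
word-length free; its hypothesis `hfar` («no frame of a sound well-formed stack over `(A, u, 0)` carries the far
lattice `B·Λ₀`») was so far supplied per length by explicit letter computations (`image_ne_of_terrace_word{,_three}`).
Here it is reduced, for a far lattice presented by ANY reduced admissible word `κ ≠ []` over `A`, to the finite check
that `κ` is not (as a mirror sequence) the depth-`|κ|` RAY WORD of `(A, u)` for either admissible first push normal —
by rigidity of reduced words (`map_reflection_eq_of_image_eq`) and the forced-ray structure of stacks
(`not_suffix_of_ray`).

* **`image_ne_of_rayWord_ne`** — the statement above; its conclusion has exactly the shape of `hfar`.

WHAT THIS IS NOT: the evaluation of the ray words (per steering, `ray_push_cubic`) is the certificate's business; not the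
stub; F-C1 not moved.
-/

noncomputable section

namespace Summit.Ventures.Crystal3D.Theorems

open Summit.Ventures.Crystal3D Finset
open Literature.MathematicalPhysics.StatisticalMechanics (fccStacking)
open scoped InnerProductSpace

/-- **`hfar` from the ray words.**  If `B·Λ₀ = (wordFrame A κ)·Λ₀` for a reduced admissible word `κ ≠ []`, and for both
admissible first push normals `n` of `(A, u)` the depth-`|κ|` ray word is not `κ` as a mirror sequence, then no frame of
a sound well-formed `z`-stack over `(A, u, 0)` carries the lattice `B·Λ₀`. -/
theorem image_ne_of_rayWord_ne {A B : EuclideanSpace ℝ (Fin 3) ≃ₗᵢ[ℝ] EuclideanSpace ℝ (Fin 3)}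
    {u z : EuclideanSpace ℝ (Fin 3)} (κ : List (EuclideanSpace ℝ (Fin 3)))
    (hκl : ∀ μ ∈ κ, ‖μ‖ = 1 ∧
      ∀ w ∈ fccSlots, ⟪w, μ⟫_ℝ = 0 ∨ ⟪w, μ⟫_ℝ = Real.sqrt (2 / 3) ∨ ⟪w, μ⟫_ℝ = -Real.sqrt (2 / 3))
    (hκc : List.IsChain (fun μ μ' => ⟪μ, μ'⟫_ℝ = 1 / 3 ∨ ⟪μ, μ'⟫_ℝ = -1 / 3) κ) (hκ : κ ≠ [])
    (hB : B '' fccStacking 1 (Real.sqrt (2 / 3)) = (wordFrame A κ) '' fccStacking 1 (Real.sqrt (2 / 3)))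
    (hray : ∀ n : EuclideanSpace ℝ (Fin 3), ‖n‖ = 1 →
      (∀ w ∈ fccSlots, ⟪A w, n⟫_ℝ = 0 ∨ ⟪A w, n⟫_ℝ = Real.sqrt (2 / 3) ∨ ⟪A w, n⟫_ℝ = -Real.sqrt (2 / 3)) →
      ⟪A u, n⟫_ℝ = Real.sqrt (2 / 3) →
      (rayWord z ⟨A, u, 0⟩ n κ.length).map (fun μ => (ℝ ∙ μ)ᗮ.reflection) ≠
        κ.map (fun μ => (ℝ ∙ μ)ᗮ.reflection)) :
    ∀ stk : List WalkEntry, StackSound z stk → StackWF z stk → stk.getLast? = some ⟨A, u, 0⟩ →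
      ∀ e ∈ stk, e.frame '' fccStacking 1 (Real.sqrt (2 / 3)) ≠ B '' fccStacking 1 (Real.sqrt (2 / 3)) := by
  intro stk hS hW hl e he hEq
  obtain ⟨r, hS', hW', hl'⟩ := exists_suffix_of_mem stk e he hS hW
  rw [hl] at hl'
  obtain ⟨hαl, hαc⟩ := stackWord_letters _ hS' hW'
  have hF : e.frame = wordFrame A (stackWord (e :: r)) := by
    rw [frame_eq_wordFrame e r hS', stackBase_eq_of_getLast? hl']
  have himg := image_fccSlots_eq_of_image_fcc_eq _ _ (hEq.trans hB)
  rw [hF] at himg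
  have hmap := map_reflection_eq_of_image_eq A hαl hαc hκl hκc himg
  exact not_suffix_of_ray κ hκ hray r e hS' hW' hl' ⟨[], by rw [List.nil_append]; exact hmap⟩

/-- **`hfar` from the ray words, membership form** (the hypothesis shape of the frame-set ledgers: no frame of the family
`M := {frames of sound well-formed stacks over (A, u, 0)}` has the far lattice). -/
theorem frame_image_ne_of_rayWord_ne {A B : EuclideanSpace ℝ (Fin 3) ≃ₗᵢ[ℝ] EuclideanSpace ℝ (Fin 3)}
    {u z : EuclideanSpace ℝ (Fin 3)} (κ : List (EuclideanSpace ℝ (Fin 3)))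
    (hκl : ∀ μ ∈ κ, ‖μ‖ = 1 ∧
      ∀ w ∈ fccSlots, ⟪w, μ⟫_ℝ = 0 ∨ ⟪w, μ⟫_ℝ = Real.sqrt (2 / 3) ∨ ⟪w, μ⟫_ℝ = -Real.sqrt (2 / 3))
    (hκc : List.IsChain (fun μ μ' => ⟪μ, μ'⟫_ℝ = 1 / 3 ∨ ⟪μ, μ'⟫_ℝ = -1 / 3) κ) (hκ : κ ≠ [])
    (hB : B '' fccStacking 1 (Real.sqrt (2 / 3)) = (wordFrame A κ) '' fccStacking 1 (Real.sqrt (2 / 3)))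
    (hray : ∀ n : EuclideanSpace ℝ (Fin 3), ‖n‖ = 1 →
      (∀ w ∈ fccSlots, ⟪A w, n⟫_ℝ = 0 ∨ ⟪A w, n⟫_ℝ = Real.sqrt (2 / 3) ∨ ⟪A w, n⟫_ℝ = -Real.sqrt (2 / 3)) →
      ⟪A u, n⟫_ℝ = Real.sqrt (2 / 3) →
      (rayWord z ⟨A, u, 0⟩ n κ.length).map (fun μ => (ℝ ∙ μ)ᗮ.reflection) ≠
        κ.map (fun μ => (ℝ ∙ μ)ᗮ.reflection))
    {F : EuclideanSpace ℝ (Fin 3) ≃ₗᵢ[ℝ] EuclideanSpace ℝ (Fin 3)}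
    (hF : ∃ stk : List WalkEntry, StackSound z stk ∧ StackWF z stk ∧ stk.getLast? = some ⟨A, u, 0⟩ ∧
      ∃ e ∈ stk, e.frame = F) :
    F '' fccStacking 1 (Real.sqrt (2 / 3)) ≠ B '' fccStacking 1 (Real.sqrt (2 / 3)) := by
  obtain ⟨stk, hS, hW, hl, e, he, rfl⟩ := hF
  exact image_ne_of_rayWord_ne κ hκl hκc hκ hB hray stk hS hW hl e he

end Summit.Ventures.Crystal3D.Theorems

end
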